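import Summits.QuantumFields.YangMills.Theorems.FluctuationComparisonRegPrIntLS2BetaDatumGaugeWLOG
import HarnessLib

/-!
# S2β · strata residue of GAP♯∘ — THE DATUM-GAUGE WLOG AT THE LEVEL OF THE STRATUM GAP BODY: the `hIrr`∕`hA`-shaped conclusion of
# ✓`gapStratum_of_letters`∕✓p823271 `gapStratum_of_axialLetters` for guard `G` ⟸ the SAME body for a «good-gauge» guard `G′` + a gauge SUPPLIER
# `G V → ∃ u, G′(u•V)` — so the (L♭) guard «`arc(V e) ≤ M(L)`» of ✓p823489 may be ADDED to the stratum guard and removed at the end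

Cell `ym3-torus` (rung R3 = continuum `SU(2)` Yang–Mills on T³ — NOT d = 4, NOT infinite volume, NOT a mass gap, NOT Clay).  Width seat «width 12» `ym3-torus-px12`
(gen 24); `--kind proof --supports stmt-QuantumFields-20520 --as helper`, count-neutral, DEFINITION-FREE (0 `def`∕`instance`∕`notation`∕`sorry`).

WHY.  ✓p822838 `…S2BetaDatumGaugeWLOG` moved the two v2 LETTERS (D♮)∕(F♮) between guards; after px16 g21's FINDING #2 the letters of record are the
gauge-conditioned (D-ax)∕(F-ax) of ✓p823271, and the distance chain (✓p823624 `AxStage`, ✓p824471 feedback dock, ✓p823489 (L♭)) needs the datum in a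
small-bond gauge (`arc(V e) ≤ M(L)`, UV3-NODE §84.3∕§84.6 (1)).  The cleanest place to insert and remove that guard is the stratum gap BODY itself: it is
invariant under `(V, U₀, U) ↦ (u•V, û•U₀, û•U)`, `û := liftTransfTo u` — the action and `minActionRegPr` are invariant (✓`wilsonAction4_gaugeAct`, lit
✓`minActionRegPr_gaugeAct`), the argmin set and the fibre are carried along (✓p822838 `mem_argmin_gaugeAct_liftTransfTo`∕`mem_fibre_gaugeAct_liftTransfTo`),
and the residual-orbit infimum does not increase: for every residual `w`, `w′ := û⁻¹·w·û` is residual (✓`residual_conj_liftTransfTo`) with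
`d²(U, w′•U₀) = d²(û•U, w•(û•U₀))` (✓`sum_dist1_sq_gaugeAct`, ✓`gaugeAct_gaugeAct_conj`), so `⨅_{w′} d²(U, w′•U₀) ≤ ⨅_w d²(û•U, w•(û•U₀))`
(✓`iInf_orbitDistSq_le_of_residual`, `le_ciInf`).
* ★★★ `gapStratum_of_goodGauge (G G′) (hsupp) (hbody′)` : the stratum gap body for guard `G` from the body for guard `G′` and the supplier.
USE: run ✓p823271 with the guard `G′ := G ∧ «arc(V e) ≤ M(L)»` (so ✓p823489's (L♭) applies inside (D-stage)), then this file with a small-bond-gauge supplier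
(§84.3 (S1)∕(S2), un-held) returns the body for the stratum guard `G` that ✓`uniformFibreGapOrbit_of_strata` consumes.

HONEST SCOPE.  Gauge-covariance plumbing; `hsupp` and the `G′`-body are HYPOTHESES; nothing of Bałaban's analysis asserted ([Balaban1985Variational] p.278 «𝔘_k is
gauge invariant», Thm 1 p.279); hIrr∕hA, GAP♯∘ (`stub_uniformFibreGapOrbit`), S2β, crux 20520 and `YM3TorusSU2` NOT proved; no registered stub closed; rung R3 =
SU(2) YM₃ on T³ — NOT d = 4, NOT infinite volume, NOT a mass gap, NOT Clay; the Yang–Mills mass gap is NOT proved.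
-/

set_option autoImplicit false

noncomputable section

namespace Summit.QuantumFields.YangMills.Theorems.FluctuationComparisonRegPrIntLS2BetaStratumBodyGaugeWLOG

open Finset
open Literature.MathematicalPhysics.QuantumFieldTheory.Balaban1983to89
open T4Continuum T3ContinuumYM3Torus T3UnitScaleTilt T3TiltDescent T3LevelShift BlockAveraging
open T3UnitLawDensityEML (ℰp)
open T3ConstrainedMinimiser (fibre)
open T3PrintedRegularMinimiser (minActionRegPr)
open T3PrintedRegularOrbits (liftTransfTo minActionRegPr_gaugeAct plaqSmall_gaugeAct_iff')
open Summit.QuantumFields.YangMills.Theorems.FluctuationComparisonRegPrIntLS2BetaResidualGauge (gaugeAct_mem_histGood_iff wilsonAction4_gaugeAct residual_one)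
open Summit.QuantumFields.YangMills.Theorems.FluctuationComparisonRegPrIntLS2BetaOrbitDistComparison (sum_dist1_sq_gaugeAct iInf_orbitDistSq_le_of_residual)
open Summit.QuantumFields.YangMills.Theorems.FluctuationComparisonRegPrIntLS2BetaDatumGaugeWLOG
  (gaugeAct_gaugeAct_conj mem_argmin_gaugeAct_liftTransfTo mem_fibre_gaugeAct_liftTransfTo residual_conj_liftTransfTo)

/-- ★★★ **THE DATUM-GAUGE WLOG FOR THE STRATUM GAP BODY.**  If every `G`-datum has a gauge representative satisfying `G′` (supplier `hsupp`, in the prefix), and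
the stratum gap body (the conclusion of ✓`gapStratum_of_letters` ∕ ✓`gapStratum_of_axialLetters`) holds with guard `G′`, then it holds with guard `G` — the same
`μ`; the residual-orbit infimum is carried by `w ↦ û⁻¹·w·û`. [cite: Balaban1985Variational, p.278 (sentence after (3)), (4) p.278, Thm 1 p.279] -/
theorem gapStratum_of_goodGauge (G G' : (F : T3Family) → (J : ℕ) → GaugeField (F.P J) 0 (Matrix.specialUnitaryGroup (Fin 2) ℂ) → Prop)
    (hsupp : ∀ (L : ℕ), ∃ c₀ : ℝ, 0 < c₀ ∧ c₀ ≤ 1 ∧ ∀ (cw : ℝ), 0 < cw → cw ≤ c₀ → ∃ pS : ℝ, ∀ (b₀ p₀ : ℝ), 0 < b₀ → pS ≤ p₀ → 0 < p₀ →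
      ∃ γ₁ : ℝ, 0 < γ₁ ∧ ∀ (F : T3Family) (γ : ℝ), F.L = L → 0 < γ → γ ≤ γ₁ →
        ∀ (J : ℕ) (V : GaugeField (F.P J) 0 (Matrix.specialUnitaryGroup (Fin 2) ℂ)), PlaqSmall (θBal F.L γ (cw * b₀) p₀ J) V → G F J V →
          ∃ u : GaugeTransf (F.P J) 0 (Matrix.specialUnitaryGroup (Fin 2) ℂ), G' F J (GaugeField.gaugeAct u V))
    (hbody' : ∀ (L : ℕ), ∃ c₀ : ℝ, 0 < c₀ ∧ c₀ ≤ 1 ∧ ∀ (cw : ℝ), 0 < cw → cw ≤ c₀ → ∃ pS : ℝ, ∀ (b₀ p₀ : ℝ), 0 < b₀ → pS ≤ p₀ → 0 < p₀ → ∃ ε₁ : ℝ, 0 < ε₁ ∧ ∀ (ε₀ : ℝ), 0 < ε₀ → ε₀ ≤ ε₁ →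
    ∃ γ₁ : ℝ, 0 < γ₁ ∧ ∃ μ : ℝ, 0 < μ ∧ ∀ (F : T3Family) (γ : ℝ), F.L = L → 0 < γ → γ ≤ γ₁ →
      ∀ (J K : ℕ) (hJK : J ≤ K) (V : GaugeField (F.P J) 0 (Matrix.specialUnitaryGroup (Fin 2) ℂ)), PlaqSmall (θBal F.L γ (cw * b₀) p₀ J) V →
        G' F J V →
        ∀ U₀ ∈ {U' : GaugeField (F.P K) 0 (Matrix.specialUnitaryGroup (Fin 2) ℂ) | U' ∈ fibre F ℰp J K hJK V ∧ U' ∈ histGood F ℰp (θBal F.L γ b₀ p₀) K J ∧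
            wilsonAction4 U' = minActionRegPr F J K hJK ε₀ V},
        ∀ U ∈ fibre F ℰp J K hJK V, U ∈ histGood F ℰp (θBal F.L γ b₀ p₀) K J →
          μ * ((F.L : ℝ)⁻¹) ^ (2 * (K - J)) *
              (⨅ w : {w : GaugeTransf (F.P K) 0 (Matrix.specialUnitaryGroup (Fin 2) ℂ) | ∀ U : GaugeField (F.P K) 0 (Matrix.specialUnitaryGroup (Fin 2) ℂ),
                  descendTo F ℰp J K hJK (GaugeField.gaugeAct w U) = descendTo F ℰp J K hJK U}, ∑ ℓ : PBond (F.P K) 0,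
                dist1 (U ℓ * ((GaugeField.gaugeAct (w : GaugeTransf (F.P K) 0 (Matrix.specialUnitaryGroup (Fin 2) ℂ)) U₀) ℓ)⁻¹) ^ 2)
            ≤ wilsonAction4 U - minActionRegPr F J K hJK ε₀ V) :
    ∀ (L : ℕ), ∃ c₀ : ℝ, 0 < c₀ ∧ c₀ ≤ 1 ∧ ∀ (cw : ℝ), 0 < cw → cw ≤ c₀ → ∃ pS : ℝ, ∀ (b₀ p₀ : ℝ), 0 < b₀ → pS ≤ p₀ → 0 < p₀ → ∃ ε₁ : ℝ, 0 < ε₁ ∧ ∀ (ε₀ : ℝ), 0 < ε₀ → ε₀ ≤ ε₁ →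
    ∃ γ₁ : ℝ, 0 < γ₁ ∧ ∃ μ : ℝ, 0 < μ ∧ ∀ (F : T3Family) (γ : ℝ), F.L = L → 0 < γ → γ ≤ γ₁ →
      ∀ (J K : ℕ) (hJK : J ≤ K) (V : GaugeField (F.P J) 0 (Matrix.specialUnitaryGroup (Fin 2) ℂ)), PlaqSmall (θBal F.L γ (cw * b₀) p₀ J) V →
        G F J V →
        ∀ U₀ ∈ {U' : GaugeField (F.P K) 0 (Matrix.specialUnitaryGroup (Fin 2) ℂ) | U' ∈ fibre F ℰp J K hJK V ∧ U' ∈ histGood F ℰp (θBal F.L γ b₀ p₀) K J ∧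
            wilsonAction4 U' = minActionRegPr F J K hJK ε₀ V},
        ∀ U ∈ fibre F ℰp J K hJK V, U ∈ histGood F ℰp (θBal F.L γ b₀ p₀) K J →
          μ * ((F.L : ℝ)⁻¹) ^ (2 * (K - J)) *
              (⨅ w : {w : GaugeTransf (F.P K) 0 (Matrix.specialUnitaryGroup (Fin 2) ℂ) | ∀ U : GaugeField (F.P K) 0 (Matrix.specialUnitaryGroup (Fin 2) ℂ),
                  descendTo F ℰp J K hJK (GaugeField.gaugeAct w U) = descendTo F ℰp J K hJK U}, ∑ ℓ : PBond (F.P K) 0,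
                dist1 (U ℓ * ((GaugeField.gaugeAct (w : GaugeTransf (F.P K) 0 (Matrix.specialUnitaryGroup (Fin 2) ℂ)) U₀) ℓ)⁻¹) ^ 2)
            ≤ wilsonAction4 U - minActionRegPr F J K hJK ε₀ V := by
  intro L
  obtain ⟨c₁, hc₁, hc₁1, H1⟩ := hbody' L
  obtain ⟨c₂, hc₂, -, H2⟩ := hsupp L
  refine ⟨min c₁ c₂, lt_min hc₁ hc₂, (min_le_left _ _).trans hc₁1, fun cw hcw hcwle => ?_⟩
  obtain ⟨pS₁, H1⟩ := H1 cw hcw (hcwle.trans (min_le_left _ _))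
  obtain ⟨pS₂, H2⟩ := H2 cw hcw (hcwle.trans (min_le_right _ _))
  refine ⟨max pS₁ pS₂, fun b₀ p₀ hb hpS hp => ?_⟩
  obtain ⟨ε₁, hε₁, H1⟩ := H1 b₀ p₀ hb ((le_max_left _ _).trans hpS) hp
  obtain ⟨γS, hγS, H2⟩ := H2 b₀ p₀ hb ((le_max_right _ _).trans hpS) hp
  refine ⟨ε₁, hε₁, fun ε₀ hε₀ hε₀le => ?_⟩
  obtain ⟨γD, hγD, μ, hμ, H1⟩ := H1 ε₀ hε₀ hε₀le
  refine ⟨min γD γS, lt_min hγD hγS, μ, hμ, fun F γ hFL hγ hγle J K hJK V hV hG U₀ hU₀ U hU hUg => ?_⟩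
  obtain ⟨u, hG'⟩ := H2 F γ hFL hγ (hγle.trans (min_le_right _ _)) J V hV hG
  set û := liftTransfTo F J K hJK u with hû
  have hV' : PlaqSmall (θBal F.L γ (cw * b₀) p₀ J) (GaugeField.gaugeAct u V) := (plaqSmall_gaugeAct_iff' _ u V).mpr hV
  have h := H1 F γ hFL hγ (hγle.trans (min_le_left _ _)) J K hJK (GaugeField.gaugeAct u V) hV' hG'
    (GaugeField.gaugeAct û U₀) (mem_argmin_gaugeAct_liftTransfTo F hJK hε₀.le u V hU₀)
    (GaugeField.gaugeAct û U) (mem_fibre_gaugeAct_liftTransfTo F hJK u V hU) ((gaugeAct_mem_histGood_iff F û _ J U).mpr hUg)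
  rw [wilsonAction4_gaugeAct, minActionRegPr_gaugeAct F hJK hε₀.le] at h
  -- the residual-orbit infimum over `V` is below the one over `u•V`
  haveI : Nonempty {w : GaugeTransf (F.P K) 0 (Matrix.specialUnitaryGroup (Fin 2) ℂ) | ∀ U : GaugeField (F.P K) 0 (Matrix.specialUnitaryGroup (Fin 2) ℂ),
      descendTo F ℰp J K hJK (GaugeField.gaugeAct w U) = descendTo F ℰp J K hJK U} := ⟨⟨fun _ => 1, residual_one F hJK⟩⟩
  have hinf : (⨅ w : {w : GaugeTransf (F.P K) 0 (Matrix.specialUnitaryGroup (Fin 2) ℂ) | ∀ U : GaugeField (F.P K) 0 (Matrix.specialUnitaryGroup (Fin 2) ℂ),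
          descendTo F ℰp J K hJK (GaugeField.gaugeAct w U) = descendTo F ℰp J K hJK U}, ∑ ℓ : PBond (F.P K) 0,
        dist1 (U ℓ * ((GaugeField.gaugeAct (w : GaugeTransf (F.P K) 0 (Matrix.specialUnitaryGroup (Fin 2) ℂ)) U₀) ℓ)⁻¹) ^ 2) ≤
      ⨅ w : {w : GaugeTransf (F.P K) 0 (Matrix.specialUnitaryGroup (Fin 2) ℂ) | ∀ U : GaugeField (F.P K) 0 (Matrix.specialUnitaryGroup (Fin 2) ℂ),
          descendTo F ℰp J K hJK (GaugeField.gaugeAct w U) = descendTo F ℰp J K hJK U}, ∑ ℓ : PBond (F.P K) 0,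
        dist1 ((GaugeField.gaugeAct û U) ℓ * ((GaugeField.gaugeAct (w : GaugeTransf (F.P K) 0 (Matrix.specialUnitaryGroup (Fin 2) ℂ)) (GaugeField.gaugeAct û U₀)) ℓ)⁻¹) ^ 2 := by
    refine le_ciInf fun w => ?_
    have hw' := residual_conj_liftTransfTo F hJK u w.2
    refine (iInf_orbitDistSq_le_of_residual F hJK U U₀ hw').trans (le_of_eq ?_)
    rw [← sum_dist1_sq_gaugeAct û U, gaugeAct_gaugeAct_conj]
  have hp0 : (0 : ℝ) ≤ μ * ((F.L : ℝ)⁻¹) ^ (2 * (K - J)) := by positivity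
  exact (mul_le_mul_of_nonneg_left hinf hp0).trans h

end Summit.QuantumFields.YangMills.Theorems.FluctuationComparisonRegPrIntLS2BetaStratumBodyGaugeWLOG

end
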